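import Mathlib.Analysis.Normed.Group.FunctionSeries
import Literature.Barriers.CriticalPhenomena.WeaklySAWQuadraticFlowDeriv
import HarnessLib

/-!
# [BBS-rg-flow, Lemma 2.3 / Proposition 1.2]: the derivative `V̄_j'` of the quadratic flow in the
# initial condition is continuous — `V̄_j` is continuously differentiable in `ḡ₀`

Continuation of `WeaklySAWQuadraticFlowDeriv.lean` (`hasDerivAt_flow`: `V̄_j = (ḡ_j, z̄_j, μ̄_j)` is
differentiable in `g₀ ∈ (0,b)` with derivative `(gbarDeriv, zbarDeriv, mubarDeriv)` and the bounds
(2.33)). Source: Bauerschmidt–Brydges–Slade, *Structural stability of a dynamical system near a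
non-hyperbolic fixed point*, AHP 16 (2015), arXiv:1211.2477, §2.4, proof of Proposition 1.2: "their
differentiability in the initial condition `ḡ₀` follows from Lemma 2.3", with Proposition 1.2 read in
BBS 2015, Proposition 6.1.1 as "`V̄_j` is continuously differentiable in the initial condition `ḡ₀`";
and the proof of Theorem 1.4(ii): "By Proposition 1.2, `V̄_j` is continuously differentiable in `g₀`
for each `j ∈ ℕ₀`."

The continuity of `ḡ_j' = ∏_{l<j}(1 - 2β_lḡ_l)` is that of a polynomial; for `z̄_j'` and `μ̄_j'` —
the termwise derivatives of the series (2.14), (2.19) — it is the Weierstrass M-test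
(`continuousOn_tsum`) with the same `g₀`-uniform majorants on intervals `(a, b)`, `a > 0`, that
justified the termwise differentiation.

## What this file proves (no definition, no named fact)

Under `CutoffQuadHyp P Ω k B c N C lam b` and `8B²C_{2,0}b ≤ 1`, for every `0 < a < b`:
* `continuous_gbarDeriv`; `continuousOn_zetaInvProd`, `continuousOn_zetaLogDeriv`,
  `continuousOn_zbarDerivTerm`, **`continuousOn_zbarDeriv`** (`g₀ ↦ z̄_j'` is continuous on `(a,b)`);
* `continuousOn_zbar`, `continuousOn_tau`, `continuousOn_sigma`, `continuousOn_tauDeriv`,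
  `continuousOn_sigmaDeriv`, `continuousOn_lamInvProd`, `continuousOn_lamLogDeriv`,
  `continuousOn_mubarDerivTerm`, **`continuousOn_mubarDeriv`**;
* **`continuousAt_flowDeriv`** — at every `g₀ ∈ (0,b)` the three derivatives `ḡ_j'`, `z̄_j'`, `μ̄_j'`
  are continuous: with `hasDerivAt_flow`, `V̄_j` is `C¹` in the initial condition.
-/

noncomputable section

open Filter Topology Set Finset
open scoped BigOperators

namespace Literature.Barriers.CriticalPhenomena

namespace CTWSAW

/-- `ḡ_j' = ∏_{l<j}(1 - 2β_lḡ_l)` is continuous in `g₀` (a polynomial). [cite: BauerschmidtBrydgesSlade2015Flow, Lemma 2.3, (2.35)] -/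
theorem continuous_gbarDeriv (β : ℕ → ℝ) (j : ℕ) : Continuous fun g => gbarDeriv β g j := by
  unfold gbarDeriv
  exact continuous_finsetProd _ fun l _ =>
    continuous_const.sub (continuous_const.mul (continuous_gbar β l))

section

variable {P : QuadFlowParams} {Ω : ℝ} {k : ℕ∞} {B c : ℝ} {N : ℕ} {C lam b : ℝ}

/-- `Π^ζ_{j,l}` is continuous in `g₀` on `(0,b]` (all factors nonzero there). [cite: BauerschmidtBrydgesSlade2015Flow, Lemma 2.2 (proof) and Lemma 2.3] -/
theorem continuousOn_zetaInvProd (hb : CutoffQuadHyp P Ω k B c N C lam b) (j l : ℕ) :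
    ContinuousOn (fun g => P.zetaInvProd g j l) (Ioc 0 b) := fun _ hg =>
  (hasDerivAt_zetaInvProd P (hb.mono hg.1 hg.2).one_sub_zeta_mul_gbar_ne_zero j l).continuousAt
    |>.continuousWithinAt

/-- `Σ^ζ_{j,l}` is continuous in `g₀` on `(0,b]`. [cite: BauerschmidtBrydgesSlade2015Flow, Lemma 2.3 (proof, σ_{j,l}')] -/
theorem continuousOn_zetaLogDeriv (hb : CutoffQuadHyp P Ω k B c N C lam b) (j l : ℕ) :
    ContinuousOn (fun g => P.zetaLogDeriv g j l) (Ioc 0 b) := by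
  unfold QuadFlowParams.zetaLogDeriv
  refine continuousOn_finsetSum _ fun i _ => ?_
  refine ((continuous_const.mul (continuous_gbarDeriv P.β (i + j))).continuousOn).mul ?_
  refine ContinuousOn.inv₀ (continuous_const.sub (continuous_const.mul (continuous_gbar P.β (i + j)))).continuousOn
    fun g hg => (hb.mono hg.1 hg.2).one_sub_zeta_mul_gbar_ne_zero (i + j)

/-- The `l`-th termwise derivative of (2.14) is continuous in `g₀` on `(0,b]`. [cite: BauerschmidtBrydgesSlade2015Flow, Lemma 2.3, (zbarprime)] -/
theorem continuousOn_zbarDerivTerm (hb : CutoffQuadHyp P Ω k B c N C lam b) (j l : ℕ) :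
    ContinuousOn (fun g => P.zbarDerivTerm g j l) (Ioc 0 b) := by
  unfold QuadFlowParams.zbarDerivTerm QuadFlowParams.zetaInvProdDeriv
  refine (((continuousOn_zetaInvProd hb j l).mul (continuousOn_zetaLogDeriv hb j l)).mul
    (continuous_const.mul ((continuous_gbar P.β (l + j)).pow 2)).continuousOn).add
    ((continuousOn_zetaInvProd hb j l).mul ?_)
  exact (continuous_const.mul ((continuous_const.mul (continuous_gbar P.β (l + j))).mul
    (continuous_gbarDeriv P.β (l + j)))).continuousOn

/-- **`g₀ ↦ z̄_j'` is continuous on `(a, b)`** for every `0 < a < b` (Weierstrass M-test with the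
`g₀`-uniform majorant of the termwise differentiation). [cite: BauerschmidtBrydgesSlade2015Flow, Lemma 2.3 and Proposition 1.2 (V̄_j continuously differentiable in ḡ₀)] -/
theorem continuousOn_zbarDeriv (hb : CutoffQuadHyp P Ω k B c N C lam b)
    (hsmall : 8 * B ^ 2 * ((1 + N) / c + N + 2 * Ω / (Ω - 1)) * b ≤ 1) {a : ℝ} (ha : 0 < a)
    (j : ℕ) : ContinuousOn (fun g => P.zbarDeriv g j) (Ioo a b) := by
  have hGb := hb.toCutoffGbarHyp
  have hC := hb.C_nonneg
  have hC20 := hGb.C20_nonneg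
  have hsm : ∀ x : ℝ, x ≤ b → 8 * B ^ 2 * ((1 + N) / c + N + 2 * Ω / (Ω - 1)) * x ≤ 1 := fun x hx =>
    le_trans (mul_le_mul_of_nonneg_left hx (mul_nonneg (by positivity) hC20)) hsmall
  have hyp : ∀ x ∈ Ioo a b, CutoffQuadHyp P Ω k B c N C lam x := fun x hx =>
    hb.mono (ha.trans hx.1) hx.2.le
  have hmono : ∀ x ∈ Ioo a b, ∀ n, gbar P.β x n ≤ gbar P.β b n := fun x hx n =>
    hGb.gbar_mono_init hsmall n (ha.trans hx.1) hx.2.le le_rfl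
  obtain ⟨hs2, -⟩ := hGb.summable_weight_mul_gbar_sq j
  obtain ⟨hs3, -⟩ := hGb.tsum_weight_mul_gbar_cube_le j
  set A : ℝ := 4 * C ^ 2 * ((1 + N) / c + N + 2 * Ω / (Ω - 1)) * (cutoffWeight Ω k j * gbar P.β b j) /
    a ^ 2 with hA
  set A' : ℝ := 4 * C / a ^ 2 with hA'
  have hu_sum : Summable fun l => A * (cutoffWeight Ω k (l + j) * gbar P.β b (l + j) ^ 2) +
      A' * (cutoffWeight Ω k (l + j) * gbar P.β b (l + j) ^ 3) :=
    (hs2.mul_left A).add (hs3.mul_left A')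
  refine continuousOn_tsum (fun l => (continuousOn_zbarDerivTerm hb j l).mono fun x hx =>
    ⟨ha.trans hx.1, hx.2.le⟩) hu_sum fun l x hx => ?_
  have hGx := (hyp x hx).toCutoffGbarHyp
  have hwj := (hGx.weight_pos j).le
  have hwl := (hGx.weight_pos (l + j)).le
  have hgj := (hGx.gbar_pos j).le
  have hgl := (hGx.gbar_pos (l + j)).le
  have hnum := zbarMajorant_mono (C := C) (C20 := (1 + N) / c + N + 2 * Ω / (Ω - 1)) hC hC20 hwj hwl hgj
    hgl (hmono x hx j) (hmono x hx (l + j))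
  have hnn : 0 ≤ 4 * C ^ 2 * ((1 + N) / c + N + 2 * Ω / (Ω - 1)) * (cutoffWeight Ω k j * gbar P.β b j) *
        (cutoffWeight Ω k (l + j) * gbar P.β b (l + j) ^ 2) +
      4 * C * (cutoffWeight Ω k (l + j) * gbar P.β b (l + j) ^ 3) := le_trans (by positivity) hnum
  have hx2 : a ^ 2 ≤ x ^ 2 := pow_le_pow_left₀ ha.le hx.1.le 2
  rw [Real.norm_eq_abs]
  calc |P.zbarDerivTerm x j l|
      ≤ (4 * C ^ 2 * ((1 + N) / c + N + 2 * Ω / (Ω - 1)) * (cutoffWeight Ω k j * gbar P.β x j) *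
            (cutoffWeight Ω k (l + j) * gbar P.β x (l + j) ^ 2) +
          4 * C * (cutoffWeight Ω k (l + j) * gbar P.β x (l + j) ^ 3)) / x ^ 2 :=
        (hyp x hx).abs_zbarDerivTerm_le (hsm x hx.2.le) j l
    _ ≤ (4 * C ^ 2 * ((1 + N) / c + N + 2 * Ω / (Ω - 1)) * (cutoffWeight Ω k j * gbar P.β b j) *
            (cutoffWeight Ω k (l + j) * gbar P.β b (l + j) ^ 2) +
          4 * C * (cutoffWeight Ω k (l + j) * gbar P.β b (l + j) ^ 3)) / x ^ 2 :=
        div_le_div_of_nonneg_right hnum (by positivity)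
    _ ≤ (4 * C ^ 2 * ((1 + N) / c + N + 2 * Ω / (Ω - 1)) * (cutoffWeight Ω k j * gbar P.β b j) *
            (cutoffWeight Ω k (l + j) * gbar P.β b (l + j) ^ 2) +
          4 * C * (cutoffWeight Ω k (l + j) * gbar P.β b (l + j) ^ 3)) / a ^ 2 :=
        div_le_div_of_nonneg_left hnn (by positivity) hx2
    _ = A * (cutoffWeight Ω k (l + j) * gbar P.β b (l + j) ^ 2) +
          A' * (cutoffWeight Ω k (l + j) * gbar P.β b (l + j) ^ 3) := by
        rw [hA, hA']
        ring

/-- `z̄_n` is continuous in `g₀` on `(0,b)` (it is differentiable there). [cite: BauerschmidtBrydgesSlade2015Flow, Lemma 2.3] -/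
theorem continuousOn_zbar (hb : CutoffQuadHyp P Ω k B c N C lam b)
    (hsmall : 8 * B ^ 2 * ((1 + N) / c + N + 2 * Ω / (Ω - 1)) * b ≤ 1) (n : ℕ) :
    ContinuousOn (fun g => P.zbar g n) (Ioo 0 b) := fun _ hg =>
  (hasDerivAt_zbar hb hsmall hg.1 hg.2 n).continuousAt.continuousWithinAt

/-- `τ_n` is continuous in `g₀` on `(0,b)`. [cite: BauerschmidtBrydgesSlade2015Flow, Lemma 2.3 (proof)] -/
theorem continuousOn_tau (hb : CutoffQuadHyp P Ω k B c N C lam b)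
    (hsmall : 8 * B ^ 2 * ((1 + N) / c + N + 2 * Ω / (Ω - 1)) * b ≤ 1) (n : ℕ) :
    ContinuousOn (fun g => P.tau g n) (Ioo 0 b) := fun _ hg =>
  (hasDerivAt_tau hb hsmall hg.1 hg.2 n).continuousAt.continuousWithinAt

/-- `σ_n` is continuous in `g₀` on `(0,b)`. [cite: BauerschmidtBrydgesSlade2015Flow, Lemma 2.3 (proof)] -/
theorem continuousOn_sigma (hb : CutoffQuadHyp P Ω k B c N C lam b)
    (hsmall : 8 * B ^ 2 * ((1 + N) / c + N + 2 * Ω / (Ω - 1)) * b ≤ 1) (n : ℕ) :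
    ContinuousOn (fun g => P.sigma g n) (Ioo 0 b) := fun _ hg =>
  (hasDerivAt_sigma hb hsmall hg.1 hg.2 n).continuousAt.continuousWithinAt

/-- `∏_{k=j}^{j+l}(λ_k - τ_k)⁻¹` is continuous in `g₀` on `(0,b)`. [cite: BauerschmidtBrydgesSlade2015Flow, Lemma 2.3 (proof)] -/
theorem continuousOn_lamInvProd (hb : CutoffQuadHyp P Ω k B c N C lam b)
    (hsmall : 8 * B ^ 2 * ((1 + N) / c + N + 2 * Ω / (Ω - 1)) * b ≤ 1) (j l : ℕ) :
    ContinuousOn (fun g => P.lamInvProd g j l) (Ioo 0 b) := fun _ hg =>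
  (hasDerivAt_lamInvProd hb hsmall hg.1 hg.2 j l).continuousAt.continuousWithinAt

/-- `τ_n'` is continuous in `g₀` on `(a,b)`, `a > 0`. [cite: BauerschmidtBrydgesSlade2015Flow, Lemma 2.3 (proof)] -/
theorem continuousOn_tauDeriv (hb : CutoffQuadHyp P Ω k B c N C lam b)
    (hsmall : 8 * B ^ 2 * ((1 + N) / c + N + 2 * Ω / (Ω - 1)) * b ≤ 1) {a : ℝ} (ha : 0 < a) (n : ℕ) :
    ContinuousOn (fun g => P.tauDeriv g n) (Ioo a b) := by
  unfold QuadFlowParams.tauDeriv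
  exact ((continuous_const.mul (continuous_gbarDeriv P.β n)).continuousOn).add
    (continuousOn_const.mul (continuousOn_zbarDeriv hb hsmall ha n))

/-- `σ_n'` is continuous in `g₀` on `(a,b)`, `a > 0`. [cite: BauerschmidtBrydgesSlade2015Flow, Lemma 2.3 (proof)] -/
theorem continuousOn_sigmaDeriv (hb : CutoffQuadHyp P Ω k B c N C lam b)
    (hsmall : 8 * B ^ 2 * ((1 + N) / c + N + 2 * Ω / (Ω - 1)) * b ≤ 1) {a : ℝ} (ha : 0 < a) (n : ℕ) :
    ContinuousOn (fun g => P.sigmaDeriv g n) (Ioo a b) := by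
  have hz : ContinuousOn (fun g => P.zbar g n) (Ioo a b) :=
    (continuousOn_zbar hb hsmall n).mono fun x hx => ⟨ha.trans hx.1, hx.2⟩
  have hz' := continuousOn_zbarDeriv hb hsmall ha n
  have hg : ContinuousOn (fun g => gbar P.β g n) (Ioo a b) := (continuous_gbar P.β n).continuousOn
  have hg' : ContinuousOn (fun g => gbarDeriv P.β g n) (Ioo a b) := (continuous_gbarDeriv P.β n).continuousOn
  unfold QuadFlowParams.sigmaDeriv
  refine ((((continuousOn_const.mul hg').add (continuousOn_const.mul hz')).sub
    (continuousOn_const.mul ((continuousOn_const.mul hg).mul hg'))).sub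
    (((continuousOn_const.mul hg').mul hz).add ((continuousOn_const.mul hg).mul hz'))).sub
    (continuousOn_const.mul ((continuousOn_const.mul hz).mul hz'))

/-- `Σ^λ_{j,l}` is continuous in `g₀` on `(a,b)`, `a > 0`. [cite: BauerschmidtBrydgesSlade2015Flow, Lemma 2.3 (proof)] -/
theorem continuousOn_lamLogDeriv (hb : CutoffQuadHyp P Ω k B c N C lam b)
    (hsmall : 8 * B ^ 2 * ((1 + N) / c + N + 2 * Ω / (Ω - 1)) * b ≤ 1) {a : ℝ} (ha : 0 < a) (j l : ℕ) :
    ContinuousOn (fun g => P.lamLogDeriv g j l) (Ioo a b) := by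
  unfold QuadFlowParams.lamLogDeriv
  refine continuousOn_finsetSum _ fun i _ => ?_
  refine (continuousOn_tauDeriv hb hsmall ha (i + j)).mul ?_
  refine ContinuousOn.inv₀ (continuousOn_const.sub ((continuousOn_tau hb hsmall (i + j)).mono
    fun x hx => ⟨ha.trans hx.1, hx.2⟩)) fun g hg => ?_
  exact (hb.mono (ha.trans hg.1) hg.2.le).lam_sub_tau_ne_zero (i + j)

/-- The `l`-th termwise derivative of (2.19) is continuous in `g₀` on `(a,b)`, `a > 0`.
[cite: BauerschmidtBrydgesSlade2015Flow, Lemma 2.3 (proof, μ̄_j')] -/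
theorem continuousOn_mubarDerivTerm (hb : CutoffQuadHyp P Ω k B c N C lam b)
    (hsmall : 8 * B ^ 2 * ((1 + N) / c + N + 2 * Ω / (Ω - 1)) * b ≤ 1) {a : ℝ} (ha : 0 < a) (j l : ℕ) :
    ContinuousOn (fun g => P.mubarDerivTerm g j l) (Ioo a b) := by
  have hΛ : ContinuousOn (fun g => P.lamInvProd g j l) (Ioo a b) :=
    (continuousOn_lamInvProd hb hsmall j l).mono fun x hx => ⟨ha.trans hx.1, hx.2⟩
  have hσ : ContinuousOn (fun g => P.sigma g (l + j)) (Ioo a b) :=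
    (continuousOn_sigma hb hsmall (l + j)).mono fun x hx => ⟨ha.trans hx.1, hx.2⟩
  unfold QuadFlowParams.mubarDerivTerm QuadFlowParams.lamInvProdDeriv
  exact ((hΛ.mul (continuousOn_lamLogDeriv hb hsmall ha j l)).mul hσ).add
    (hΛ.mul (continuousOn_sigmaDeriv hb hsmall ha (l + j)))

/-- **`g₀ ↦ μ̄_j'` is continuous on `(a, b)`** for every `0 < a < b` (M-test with the geometric
majorant of the termwise differentiation). [cite: BauerschmidtBrydgesSlade2015Flow, Lemma 2.3 and Proposition 1.2 (V̄_j continuously differentiable in ḡ₀)] -/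
theorem continuousOn_mubarDeriv (hb : CutoffQuadHyp P Ω k B c N C lam b)
    (hsmall : 8 * B ^ 2 * ((1 + N) / c + N + 2 * Ω / (Ω - 1)) * b ≤ 1) {a : ℝ} (ha : 0 < a)
    (j : ℕ) : ContinuousOn (fun g => P.mubarDeriv g j) (Ioo a b) := by
  have hGb := hb.toCutoffGbarHyp
  have hC := hb.C_nonneg
  have hC20 := hGb.C20_nonneg
  obtain ⟨hα0, hα1⟩ := hb.alpha_mem
  have hsm : ∀ x : ℝ, x ≤ b → 8 * B ^ 2 * ((1 + N) / c + N + 2 * Ω / (Ω - 1)) * x ≤ 1 := fun x hx =>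
    le_trans (mul_le_mul_of_nonneg_left hx (mul_nonneg (by positivity) hC20)) hsmall
  have hyp : ∀ x ∈ Ioo a b, CutoffQuadHyp P Ω k B c N C lam x := fun x hx =>
    hb.mono (ha.trans hx.1) hx.2.le
  have hmono : ∀ x ∈ Ioo a b, ∀ n, gbar P.β x n ≤ gbar P.β b n := fun x hx n =>
    hGb.gbar_mono_init hsmall n (ha.trans hx.1) hx.2.le le_rfl
  set M : ℝ := mubarDerivConst C ((1 + N) / c + N + 2 * Ω / (Ω - 1)) (2 / (1 + lam)) with hM
  have hM0 : 0 ≤ M := mubarDerivConst_nonneg hC hC20 hα0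
  set A : ℝ := M * (cutoffWeight Ω k j * gbar P.β b j ^ 2) / a ^ 2 with hA
  have hu_sum : Summable fun l => A * (2 / (1 + lam)) ^ (l + 1) :=
    ((summable_geometric_of_lt_one hα0 hα1).mul_left (A * (2 / (1 + lam)))).congr fun l => by ring
  have hterm : ContinuousOn (fun g => ∑' l, P.mubarDerivTerm g j l) (Ioo a b) := by
    refine continuousOn_tsum (fun l => continuousOn_mubarDerivTerm hb hsmall ha j l) hu_sum
      fun l x hx => ?_
    have hGx := (hyp x hx).toCutoffGbarHyp
    have hwj := (hGx.weight_pos j).le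
    have hgj := (hGx.gbar_pos j).le
    have hx2 : a ^ 2 ≤ x ^ 2 := pow_le_pow_left₀ ha.le hx.1.le 2
    have hnum : M * (2 / (1 + lam)) ^ (l + 1) * (cutoffWeight Ω k j * gbar P.β x j ^ 2) ≤
        M * (2 / (1 + lam)) ^ (l + 1) * (cutoffWeight Ω k j * gbar P.β b j ^ 2) := by
      have := hmono x hx j
      gcongr
    rw [Real.norm_eq_abs]
    calc |P.mubarDerivTerm x j l|
        ≤ M * (2 / (1 + lam)) ^ (l + 1) * (cutoffWeight Ω k j * gbar P.β x j ^ 2) / x ^ 2 :=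
          (hyp x hx).abs_mubarDerivTerm_le (hsm x hx.2.le) j l
      _ ≤ M * (2 / (1 + lam)) ^ (l + 1) * (cutoffWeight Ω k j * gbar P.β b j ^ 2) / x ^ 2 :=
          div_le_div_of_nonneg_right hnum (by positivity)
      _ ≤ M * (2 / (1 + lam)) ^ (l + 1) * (cutoffWeight Ω k j * gbar P.β b j ^ 2) / a ^ 2 :=
          div_le_div_of_nonneg_left (by positivity) (by positivity) hx2
      _ = A * (2 / (1 + lam)) ^ (l + 1) := by rw [hA]; ring
  show ContinuousOn (fun g => -∑' l, P.mubarDerivTerm g j l) (Ioo a b)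
  exact hterm.neg

end

/-- **[BBS-rg-flow, Proposition 1.2 / Lemma 2.3]: `V̄_j` is CONTINUOUSLY differentiable in the
initial condition** — the derivatives `ḡ_j' = gbarDeriv`, `z̄_j' = zbarDeriv`, `μ̄_j' = mubarDeriv` of
`hasDerivAt_flow` are continuous at every `g₀ ∈ (0,b)` (hypotheses of Lemma 2.2 at `b`,
`8B²C_{2,0}b ≤ 1`). [cite: BauerschmidtBrydgesSlade2015Flow, Proposition 1.2 and §2.4 ("their differentiability in the initial condition ḡ₀ follows from Lemma 2.3"); proof of Theorem 1.4(ii) ("By Proposition 1.2, V̄_j is continuously differentiable in g₀ for each j")] [cite: BauerschmidtBrydgesSlade2015LogCorr, Proposition 6.1.1 ("V̄_j is continuously differentiable in the initial condition ḡ₀")] -/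
theorem continuousAt_flowDeriv {P : QuadFlowParams} {Ω : ℝ} {k : ℕ∞} {B c : ℝ} {N : ℕ} {C lam b : ℝ}
    (hb : CutoffQuadHyp P Ω k B c N C lam b)
    (hsmall : 8 * B ^ 2 * ((1 + N) / c + N + 2 * Ω / (Ω - 1)) * b ≤ 1) {g : ℝ} (hg : 0 < g)
    (hgb : g < b) (j : ℕ) :
    ContinuousAt (fun x => gbarDeriv P.β x j) g ∧ ContinuousAt (fun x => P.zbarDeriv x j) g ∧
      ContinuousAt (fun x => P.mubarDeriv x j) g := by
  have ha : 0 < g / 2 := by positivity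
  have hmem : Ioo (g / 2) b ∈ 𝓝 g := Ioo_mem_nhds (by linarith) hgb
  exact ⟨(continuous_gbarDeriv P.β j).continuousAt,
    (continuousOn_zbarDeriv hb hsmall ha j).continuousAt hmem,
    (continuousOn_mubarDeriv hb hsmall ha j).continuousAt hmem⟩

end CTWSAW

end Literature.Barriers.CriticalPhenomena
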